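import Literature.AnabelianGeometry.SemiGraphs.PSCRamificationProofs
import HarnessLib

/-!
# [IUTchI] Rmk. 1.2.3 (iv), verticial half: the split injection `⊕_v M^unr_G[v] ↪ M^unr_G`, corrected at one vertex

Mochizuki, *Inter-universal Teichmüller theory I* [IUTchI] Rmk. 1.2.3 (iv) p. 42 (replacement text for
[CombGC] Rmk. 1.4.3, verticial part), first claim, for sturdy `G` of pro-Σ PSC-type: "the inclusions
`M^unr_G[v] ⊆ M^unr_G` determine a split injection `⊕_v M^unr_G[v] ↪ M^unr_G`".
[cite: Mochizuki2012, IUTchI Rmk 1.2.3(iv) p.42]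

SUCCESSOR RECORD (abc-iut finding F-L3t4g5-1, raised by this lineage on its own typing).  The frozen
predicate `PSCDatum.UnrVerticialSplitInjection` (`PSCRamification.lean`) renders "the `M^unr_G[v]` are
independent" through inverse images in `Π_G` as
`unrVertAbOf v ⊓ (⨆ w ≠ v, unrVertAbOf w)⁻ = unrAbKer`, where `unrAbKer = E` is the inverse image of
`0 ∈ M^unr_G`.  The inverse image of the submodule `Σ_{w ≠ v} M^unr_G[w]` is `(E ⊔ ⨆ w ≠ v, unrVertAbOf w)⁻`;
the typed clause omits `E ⊔`, which is harmless when there is a vertex `w ≠ v` (each `unrVertAbOf w`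
contains `E`) but for a ONE-VERTEX datum (every smooth curve; `i(G) = 1`) turns the empty sum into `⊥`
instead of `E` and forces `E ≤ closure {1}`, i.e. `Π` abelian — so the frozen predicate is FALSE at the
genuine datum of a smooth sturdy curve (`PSCUnrVerticialOneVertex.lean`), and with it the FACT-LIST row
F-1938 `UnrVerticialCharacterizationHolds` at the geometric origin.  This file DEFINES the corrected
predicate `UnrVerticialSplitInjection'` (both clauses written with `E ⊔ …` inside the closure) and the
corrected schema `UnrVerticialCharacterizationHolds'`, and PROVES the bridges: the frozen predicate
implies the corrected one for every datum (`UnrVerticialSplitInjection.toPrime`), they are EQUIVALENT as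
soon as the semi-graph has two distinct vertices (`unrVerticialSplitInjection'_iff`), and the corrected
schema HOLDS at every origin of smooth-proper-shaped data (`unrVerticialCharacterizationHolds'_of_smoothProper`)
— so that, with F-1938 replaced by its successor, the whole [CombGC] §1 / Rmk. 1.2.3 fact family typed
by abc-iut-L3-t4 is jointly satisfiable at a non-empty origin.  Consumers of F-1938 at multi-vertex
levels lose nothing (`UnrVerticialSplitInjection'.toOld`).  Post-freeze additive successor (review lane);
the frozen file is untouched; a FACT row is an assumption label — nothing here asserts the printed
claim for curves, and no side is taken on [IUTchIII] Cor. 3.12.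
-/

noncomputable section

namespace Literature.AnabelianGeometry.SemiGraphs

namespace PSCDatum

open scoped Pointwise

universe u

variable {P : Type u} [Group P] [TopologicalSpace P] [IsTopologicalGroup P]

/-- **[IUTchI] Remark 1.2.3 (iv)**, p. 42, verticial part, first claim, for sturdy `G` — CORRECTED
SUCCESSOR of `UnrVerticialSplitInjection` (abc-iut F-L3t4g5-1): "the inclusions `M^unr_G[v] ⊆ M^unr_G`
determine a split injection `⊕_v M^unr_G[v] ↪ M^unr_G`" — (independence) for every vertex `v`, the
inverse image of `M^unr_G[v] ∩ Σ_{w ≠ v} M^unr_G[w]` is that of `0`, i.e.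
`unrVertAbOf v ⊓ (unrAbKer ⊔ ⨆ w ≠ v, unrVertAbOf w)⁻ = unrAbKer` (the EMPTY sum being the zero
submodule, inverse image `unrAbKer`); (splitting) `M^unr-vert_G = Σ_v M^unr_G[v]` has a closed
complement.  Claim key of the IUT papers (D-0012). [cite: Mochizuki2012, IUTchI Rmk 1.2.3(iv) p.42] -/
def UnrVerticialSplitInjection' (G : PSCDatum P) : Prop :=
  G.IsSturdy →
    (∀ v : G.graph.V,
      G.unrVertAbOf v ⊓
          (G.unrAbKer ⊔ ⨆ w : {w : G.graph.V // w ≠ v}, G.unrVertAbOf w.1).topologicalClosure =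
        G.unrAbKer) ∧
    ∃ C : Subgroup P, IsClosed (C : Set P) ∧ G.unrAbKer ≤ C ∧
      C ⊓ (G.unrAbKer ⊔ ⨆ v : G.graph.V, G.unrVertAbOf v).topologicalClosure = G.unrAbKer ∧
      C ⊔ (G.unrAbKer ⊔ ⨆ v : G.graph.V, G.unrVertAbOf v).topologicalClosure = ⊤

/-- **[IUTchI] Remark 1.2.3 (iv)** (p. 42), verticial part, for every sturdy `G` of PSC-type, with the
CORRECTED split injection (successor of `UnrVerticialCharacterizationHolds`, abc-iut F-L3t4g5-1): the
split injection `⊕_v M^unr_G[v] ↪ M^unr_G` and the criterion for elementary abelian quotients.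
Claim key of the IUT papers (D-0012). [cite: Mochizuki2012, IUTchI Rmk 1.2.3(iv) p.42] -/
def UnrVerticialCharacterizationHolds' (Ω : PSCOrigin.{u}) : Prop :=
  ∀ ⦃Q : Type u⦄ [Group Q] [TopologicalSpace Q] [IsTopologicalGroup Q] (G : PSCDatum Q),
    Ω.IsOfPSCType G → G.UnrVerticialSplitInjection' ∧ G.ElementaryQuotientVerticiallyRamifiedIff

/-! ### Bridges between the frozen predicate and its successor -/

section Bridges

variable (G : PSCDatum P)

/-- `E = unrAbKer` lies in every `unrVertAbOf w` (private copy of the lemma of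
`PSCVertexQuotientProofs.lean`, to keep this file's imports light). [cite: Mochizuki2012, IUTchI Rmk 1.2.3(iv) p.42] -/
private theorem unrAbKer_le_unrVertAbOf' (w : G.graph.V) : G.unrAbKer ≤ G.unrVertAbOf w :=
  le_sup_right.trans (Subgroup.le_topologicalClosure _)

/-- `E` is closed. [cite: Mochizuki2012, IUTchI Rmk 1.2.3(iv) p.42] -/
theorem isClosed_unrAbKer : IsClosed (G.unrAbKer : Set P) := Subgroup.isClosed_topologicalClosure _

/-- With a vertex `w ≠ v` present, `E ⊔ ⨆_{w ≠ v} unrVertAbOf w = ⨆_{w ≠ v} unrVertAbOf w`: the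
corrected and the frozen independence clauses at `v` coincide. [cite: Mochizuki2012, IUTchI Rmk 1.2.3(iv) p.42] -/
theorem unrAbKer_sup_iSup_ne_eq {v : G.graph.V} (h : ∃ w : G.graph.V, w ≠ v) :
    G.unrAbKer ⊔ (⨆ w : {w : G.graph.V // w ≠ v}, G.unrVertAbOf w.1) =
      ⨆ w : {w : G.graph.V // w ≠ v}, G.unrVertAbOf w.1 := by
  obtain ⟨w, hw⟩ := h
  exact sup_eq_right.mpr ((G.unrAbKer_le_unrVertAbOf' w).trans
    (le_iSup (fun w : {w : G.graph.V // w ≠ v} => G.unrVertAbOf w.1) ⟨w, hw⟩))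

/-- With a vertex present, `E ⊔ ⨆_v unrVertAbOf v = ⨆_v unrVertAbOf v`.
[cite: Mochizuki2012, IUTchI Rmk 1.2.3(iv) p.42] -/
theorem unrAbKer_sup_iSup_eq [Nonempty G.graph.V] :
    G.unrAbKer ⊔ (⨆ v : G.graph.V, G.unrVertAbOf v) = ⨆ v : G.graph.V, G.unrVertAbOf v := by
  obtain ⟨w⟩ := ‹Nonempty G.graph.V›
  exact sup_eq_right.mpr ((G.unrAbKer_le_unrVertAbOf' w).trans (le_iSup (fun v => G.unrVertAbOf v) w))

/-- At a vertex `v` with NO other vertex the corrected independence clause holds trivially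
(`unrVertAbOf v ⊓ E⁻ = E`). [cite: Mochizuki2012, IUTchI Rmk 1.2.3(iv) p.42] -/
theorem primeIndependence_of_forall_eq {v : G.graph.V} (h : ∀ w : G.graph.V, w = v) :
    G.unrVertAbOf v ⊓
        (G.unrAbKer ⊔ ⨆ w : {w : G.graph.V // w ≠ v}, G.unrVertAbOf w.1).topologicalClosure =
      G.unrAbKer := by
  haveI : IsEmpty {w : G.graph.V // w ≠ v} := ⟨fun w => w.2 (h w.1)⟩
  rw [iSup_of_empty, sup_bot_eq, (Subgroup.topologicalClosure_minimal _ le_rfl G.isClosed_unrAbKer).antisymm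
    (Subgroup.le_topologicalClosure _)]
  exact inf_eq_right.mpr (G.unrAbKer_le_unrVertAbOf' v)

/-- **The frozen predicate implies its successor, for every datum.**
[cite: Mochizuki2012, IUTchI Rmk 1.2.3(iv) p.42] -/
theorem UnrVerticialSplitInjection.toPrime (h : G.UnrVerticialSplitInjection) :
    G.UnrVerticialSplitInjection' := fun hst => by
  obtain ⟨hind, C, hCc, hEC, hCinf, hCsup⟩ := h hst
  refine ⟨fun v => ?_, C, hCc, hEC, ?_, ?_⟩
  · by_cases hv : ∃ w : G.graph.V, w ≠ v
    · rw [G.unrAbKer_sup_iSup_ne_eq hv]; exact hind v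
    · exact G.primeIndependence_of_forall_eq fun w => not_ne_iff.mp (not_exists.mp hv w)
  · rcases isEmpty_or_nonempty G.graph.V with hV | hV
    · rw [iSup_of_empty, sup_bot_eq, (Subgroup.topologicalClosure_minimal _ le_rfl
        G.isClosed_unrAbKer).antisymm (Subgroup.le_topologicalClosure _)]
      exact inf_eq_right.mpr hEC
    · rw [G.unrAbKer_sup_iSup_eq]; exact hCinf
  · rcases isEmpty_or_nonempty G.graph.V with hV | hV
    · refine top_le_iff.mp (hCsup.ge.trans (sup_le_sup_left (Subgroup.topologicalClosure_mono ?_) C))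
      rw [iSup_of_empty]; exact bot_le
    · rw [G.unrAbKer_sup_iSup_eq]; exact hCsup

/-- **With two distinct vertices the successor implies the frozen predicate** (the clauses coincide).
[cite: Mochizuki2012, IUTchI Rmk 1.2.3(iv) p.42] -/
theorem UnrVerticialSplitInjection'.toOld [Nontrivial G.graph.V] (h : G.UnrVerticialSplitInjection') :
    G.UnrVerticialSplitInjection := fun hst => by
  obtain ⟨hind, C, hCc, hEC, hCinf, hCsup⟩ := h hst
  refine ⟨fun v => ?_, C, hCc, hEC, ?_, ?_⟩
  · rw [← G.unrAbKer_sup_iSup_ne_eq (exists_ne v)]; exact hind v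
  · rw [← G.unrAbKer_sup_iSup_eq]; exact hCinf
  · rw [← G.unrAbKer_sup_iSup_eq]; exact hCsup

/-- **The frozen predicate and its successor are equivalent for data with two distinct vertices.**
[cite: Mochizuki2012, IUTchI Rmk 1.2.3(iv) p.42] -/
theorem unrVerticialSplitInjection'_iff [Nontrivial G.graph.V] :
    G.UnrVerticialSplitInjection' ↔ G.UnrVerticialSplitInjection :=
  ⟨fun h => UnrVerticialSplitInjection'.toOld G h, fun h => UnrVerticialSplitInjection.toPrime G h⟩

/-- **At the smooth-proper shape (one vertex, `Π_v = Π`) the successor HOLDS** — where the frozen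
predicate forces `Π` abelian: independence is the trivial clause, and `C := E` is a closed complement of
`M^unr-vert_G = M^unr_G`. [cite: Mochizuki2012, IUTchI Rmk 1.2.3(iv) p.42] -/
theorem unrVerticialSplitInjection'_of_smoothProper (hV : ∀ v, G.vertGp v = ⊤) (v₀ : G.graph.V)
    (hv : ∀ w, w = v₀) : G.UnrVerticialSplitInjection' := fun _ => by
  have htop : (G.unrAbKer ⊔ ⨆ v : G.graph.V, G.unrVertAbOf v).topologicalClosure = ⊤ := by
    refine top_le_iff.mp ((le_trans ?_ (le_iSup (fun v => G.unrVertAbOf v) v₀)).trans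
      (le_sup_right.trans (Subgroup.le_topologicalClosure _)))
    exact le_trans (by rw [hV]) (le_sup_left.trans (Subgroup.le_topologicalClosure _))
  refine ⟨fun v => ?_, G.unrAbKer, G.isClosed_unrAbKer, le_rfl, ?_, ?_⟩
  · obtain rfl := hv v
    exact G.primeIndependence_of_forall_eq hv
  · rw [htop, inf_top_eq]
  · rw [htop, sup_top_eq]

end Bridges

/-! ### The schema: frozen ⇒ successor; successor holds at the smooth-proper origin -/

/-- **The frozen schema implies its successor.** [cite: Mochizuki2012, IUTchI Rmk 1.2.3(iv) p.42] -/
theorem UnrVerticialCharacterizationHolds.toPrime {Ω : PSCOrigin.{u}}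
    (h : UnrVerticialCharacterizationHolds Ω) : UnrVerticialCharacterizationHolds' Ω :=
  fun _ _ _ _ G hG => ⟨UnrVerticialSplitInjection.toPrime G (h G hG).1, (h G hG).2⟩

/-- **The successor schema recovers the frozen conclusion at data with two distinct vertices.**
[cite: Mochizuki2012, IUTchI Rmk 1.2.3(iv) p.42] -/
theorem UnrVerticialCharacterizationHolds'.splitInjection_of_nontrivial {Ω : PSCOrigin.{u}}
    (h : UnrVerticialCharacterizationHolds' Ω) {Q : Type u} [Group Q] [TopologicalSpace Q]
    [IsTopologicalGroup Q] (G : PSCDatum Q) [Nontrivial G.graph.V] (hG : Ω.IsOfPSCType G) :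
    G.UnrVerticialSplitInjection ∧ G.ElementaryQuotientVerticiallyRamifiedIff :=
  ⟨UnrVerticialSplitInjection'.toOld G (h G hG).1, (h G hG).2⟩

/-- **The successor schema HOLDS at every origin of smooth-proper-shaped data** (one vertex, no edges,
`Π_v = Π`; e.g. the genuine datum of a smooth proper genus-2 curve), the criterion for elementary abelian
quotients being a theorem for all data (`elementaryQuotientVerticiallyRamifiedIff`).  With F-1938 replaced
by this successor, the eleven-row [CombGC] §1 / Rmk. 1.2.3 fact family of abc-iut-L3-t4 is jointly
satisfiable at a non-empty origin (cf. `PSCUnrVerticialOneVertex.exists_smoothProperOrigin_holds`).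
[cite: Mochizuki2012, IUTchI Rmk 1.2.3(iv) p.42] -/
theorem unrVerticialCharacterizationHolds'_of_smoothProper (Ω : PSCOrigin.{u})
    (hΩ : ∀ ⦃Q : Type u⦄ [Group Q] [TopologicalSpace Q] (G : PSCDatum Q), Ω.IsOfPSCType G →
      IsEmpty G.graph.N ∧ IsEmpty G.graph.C ∧ (∀ v, G.vertGp v = ⊤) ∧ ∃ v₀ : G.graph.V, ∀ w, w = v₀) :
    UnrVerticialCharacterizationHolds' Ω := by
  intro Q _ _ _ G hG
  obtain ⟨-, -, hV, v₀, hv⟩ := hΩ G hG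
  exact ⟨G.unrVerticialSplitInjection'_of_smoothProper hV v₀ hv, G.elementaryQuotientVerticiallyRamifiedIff⟩

end PSCDatum

end Literature.AnabelianGeometry.SemiGraphs

end
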